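import Mathlib
import HarnessLib
import HarnessLib.Audit
import Summits.SmoothPoincare4.Statement
import Literature.Topology.FourManifolds.Knots
import Literature.Topology.FourManifolds.ConnectedSum
import Literature.Geometry.Lorentzian.PseudoRiemannianMetric
import Literature.Geometry.Lorentzian.LeviCivita
import HarnessLib.Audit.Status.Attr

/-!
Route: SmallBranchSpheres

DORMANT since 2026-08-22T16:32:18Z (reconciler: no traction for 5.5 d (last activity item-evidence-added at 2026-08-17T04:17:11Z); parked, not closed — `ledger route dormant route-SmoothPoincare4-SmallBranchSpheres --off` to reactivate) — unstaffed, not closed; items shared with open routes are served there. `ledger route dormant <id> --off` reactivates.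

# Route SmallBranchSpheres — fake 4-spheres branch over small spheres — PSC on homotopy 4-spheres
from covers of S⁴ along PSC-surgerable sphere-links, then PSC spheres are standard

It suffices to show X = PscBranchLink ∧ PscSpheresStandard, realising card
small-spheres-pay-for-the-cone (spine and only card).
PscBranchLink (COV-PSC, the card's K1): every smooth homotopy 4-sphere M is a branched cover p : M →
S⁴ in SPHERE-LINK NORMAL FORM —
2-knots K₁,…,K_m ⊂ S⁴ with disjoint tubes ν_i : S²×ℝ² ↪ S⁴, lifted tubes σ_i : S²×ℝ² ↪ M with
p(σ_i(x,w)) = ν_i(x,w²), and every point of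
M either a local-diffeomorphism point of p or on a σ-tube (so the branch locus is the sphere-link B
= ⋃K_i(S²), one index-2 ramification
sphere over each component) — such that the surgery manifold N = (S⁴ ∖ B) ∪_ν ⊔_i (B̊³×S¹) admits a
Riemannian metric of positive scalar
curvature. PscSpheresStandard (the card's K2 = target X₁ of route BachCriticalElement, same decl
text, shared): a smooth homotopy 4-sphere
carrying a metric of positive scalar curvature is diffeomorphic to S⁴. The bridge between them is
the support lemma ConeAbsorption
(the card's P1): normal form + N PSC ⇒ M PSC, which is where the mechanism lives; SphereBranchLink
is the curvature-free rung of PscBranchLink.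
(Rev 2 (cone repair 2026-08-15): the tube datum is inlined — ν i : S²×ℝ² → S⁴ a smooth embedding
with ν i (x,0) = K i x, clauses carried inside the normal-form conjunction — instead of the packaged
`TwoKnot.TubularNbhd ⇑(K i)` of GluckTwist.lean; mathematical content unchanged. The route file
therefore no longer imports GluckTwist.lean, whose module carries the unproved Freedman-dependent
fact nonempty_homeomorph_sphere_of_isGluckTwist.)
Lean: `(∀ (M : Type) [TopologicalSpace M] [T2Space M] [SecondCountableTopology M] [ChartedSpace
(EuclideanSpace ℝ (Fin 4)) M] [IsManifold (𝓡 4) ∞ M], M ≃ₕ Metric.sphere (0 : EuclideanSpace ℝ (Fin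
5)) 1 → ∃ (m : ℕ) (K : Fin m → Literature.Topology.FourManifolds.TwoKnot) (ν : Fin m →
(Metric.sphere (0 : EuclideanSpace ℝ (Fin 3)) 1) × EuclideanSpace ℝ (Fin 2) → Metric.sphere (0 :
EuclideanSpace ℝ (Fin 5)) 1) (p : M → Metric.sphere (0 : EuclideanSpace ℝ (Fin 5)) 1) (σ : Fin m →
(Metric.sphere (0 : EuclideanSpace ℝ (Fin 3)) 1) × EuclideanSpace ℝ (Fin 2) → M), (ContMDiff (𝓡 4)
(𝓡 4) ∞ p ∧ (∀ i, Manifold.IsSmoothEmbedding ((𝓡 2).prod 𝓘(ℝ, EuclideanSpace ℝ (Fin 2))) (𝓡 4) ∞ (ν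
i)) ∧ (∀ i (x : Metric.sphere (0 : EuclideanSpace ℝ (Fin 3)) 1), ν i (x, 0) = (K i) x) ∧ (∀ i j :
Fin m, i ≠ j → Disjoint (Set.range (ν i)) (Set.range (ν j))) ∧ (∀ i, Manifold.IsSmoothEmbedding ((𝓡
2).prod 𝓘(ℝ, EuclideanSpace ℝ (Fin 2))) (𝓡 4) ∞ (σ i)) ∧ (∀ i x (w : EuclideanSpace ℝ (Fin 2)), p (σ
i (x, w)) = ν i (x, (WithLp.toLp 2 ![w 0 ^ 2 - w 1 ^ 2, 2 * w 0 * w 1] : EuclideanSpace ℝ (Fin 2))))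
∧ (∀ y, IsLocalDiffeomorphAt (𝓡 4) (𝓡 4) ∞ p y ∨ ∃ i x w, y = σ i (x, w))) ∧ ∃ (N : Type) (_ :
TopologicalSpace N) (_ : T2Space N) (_ : SecondCountableTopology N) (_ : CompactSpace N) (_ :
ChartedSpace (EuclideanSpace ℝ (Fin 4)) N) (_ : IsManifold (𝓡 4) ∞ N),
Literature.Topology.FourManifolds.IsOpenGluing (𝓡 4) (𝓘(ℝ, EuclideanSpace ℝ (Fin 3)).prod (𝓡 1)) (𝓡
4) (A := ↥(⟨(⋃ i, Set.range ⇑(K i))ᶜ, (isClosed_iUnion_of_finite fun i => (K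
i).isClosed_range).isOpen_compl⟩ : TopologicalSpace.Opens (Metric.sphere (0 : EuclideanSpace ℝ (Fin
5)) 1))) (B := ↥(⟨⋃ i : Fin m, Prod.fst ⁻¹' Metric.ball (WithLp.toLp 2 ![(3 * (i : ℕ) : ℝ), 0, 0] :
EuclideanSpace ℝ (Fin 3)) 1, isOpen_iUnion fun _ => Metric.isOpen_ball.preimage continuous_fst⟩ :
TopologicalSpace.Opens ((EuclideanSpace ℝ (Fin 3)) × Metric.sphere (0 : EuclideanSpace ℝ (Fin 2))
1))) (P := N) (fun a b => ∃ (i : Fin m) (x : Metric.sphere (0 : EuclideanSpace ℝ (Fin 3)) 1) (u :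
Metric.sphere (0 : EuclideanSpace ℝ (Fin 2)) 1) (t : ℝ), t ∈ Set.Ioo (0 : ℝ) 1 ∧ (b :
(EuclideanSpace ℝ (Fin 3)) × Metric.sphere (0 : EuclideanSpace ℝ (Fin 2)) 1).1 = (WithLp.toLp 2 ![(3
* (i : ℕ) : ℝ), 0, 0] : EuclideanSpace ℝ (Fin 3)) + t • (x : EuclideanSpace ℝ (Fin 3)) ∧ (b :
(EuclideanSpace ℝ (Fin 3)) × Metric.sphere (0 : EuclideanSpace ℝ (Fin 2)) 1).2 = u ∧ (a :
Metric.sphere (0 : EuclideanSpace ℝ (Fin 5)) 1) = ν i (x, t • (u : EuclideanSpace ℝ (Fin 2)))) ∧ ∃ g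
: Literature.Geometry.Lorentzian.PseudoRiemannianMetric (𝓡 4) ∞ (EuclideanSpace ℝ (Fin 4))
(TangentSpace (𝓡 4) : N → Type _), ∃ _ : g.HasLeviCivita, g.IsRiemannian ∧ ∀ x, 0 <
g.scalarCurvature x) ∧ (∀ (M : Type) [TopologicalSpace M] [T2Space M] [SecondCountableTopology M]
[ChartedSpace (EuclideanSpace ℝ (Fin 4)) M] [IsManifold (𝓡 4) ∞ M], M ≃ₕ Metric.sphere (0 :
EuclideanSpace ℝ (Fin 5)) 1 → (∃ g : Literature.Geometry.Lorentzian.PseudoRiemannianMetric (𝓡 4) ∞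
(EuclideanSpace ℝ (Fin 4)) (TangentSpace (𝓡 4) : M → Type _), ∃ _ : g.HasLeviCivita, g.IsRiemannian
∧ ∀ x, 0 < g.scalarCurvature x) → Nonempty (M ≃ₘ⟮𝓡 4, 𝓡 4⟯ Metric.sphere (0 : EuclideanSpace ℝ (Fin
5)) 1))`

## Assembly
Pure logic, proved in the planner's Sketch.lean and certified as glue.lean (`closes (hC :
PscBranchLink) (hA : ConeAbsorption)
(hS : PscSpheresStandard) : _root_.SmoothPoincare4`, three lines: `intro M _ _ _ _ _ e; obtain ⟨m,
K, ν, p, σ, hnf, hsurg⟩ := hC M e;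
exact hS M e (hA M m K ν p σ hnf hsurg)`): SmoothPoincare4 unfolds to ∀ M (T2, second countable, C^∞
atlas on ℝ⁴), M ≃ₕ S⁴ → Nonempty
(M ≃ₘ S⁴); PscBranchLink supplies the normal-form cover with PSC surgery manifold, ConeAbsorption
turns it into a PSC metric on M, and
PscSpheresStandard gives the diffeomorphism. Every item uses the summit's own binder, so no
packaging fact enters. SphereBranchLink is a
listed rung not used by `closes` (hypotheses ⊆ items).

Rationale: WHY THIS LINE. Riemann–Hurwitz for a cover of S⁴ with index-2 ramification along embedded surfaces
gives χ(M) = 2d − Σχ(R_j); at χ(M) = 2 the branch locus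
of a fake 4-sphere MAY consist of 2-spheres only (d − 1 of them), whereas for K3 genus is forced —
and 2-spheres carry curvature to spend:
the pulled-back metric has a 4π edge-cone along each ramification sphere (−2π of Gauss–Bonnet per
normal disc, arXiv:1203.6389), which is
absorbed with scal > 0 exactly when the base metric near B is (tiny round S²) × (fat flat disc), and
such metrics on S⁴ are what
Gromov–Lawson codimension-3 surgery (GromovLawson1980; handle in standard product form, Walsh2010 =
arXiv:0811.1245) returns from a PSC metric on the
sphere-link surgery manifold N. So the existence half of the scalar-curvature attack on SPC4 — item
PscOnHomotopySpheres of routes PIC and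
BachCriticalElement, recorded there with "no mechanism", and the whole content of the closed route
PscCorkFillIn — becomes a statement
about 2-LINKS IN THE STANDARD S⁴ (doi:10.2140/gt.2002.6.393, arXiv:1602.07459, arXiv:2605.26337 for
the covering side), policed
component by component by 3+1-dimensional gauge theory (arXiv:1702.04417) and fed by fibred/ribbon
components (BamlerKleiner2019,
Montesinos-type ribbon covers). Imported areas: branched-covering presentations of 4-manifolds (PL
topology), PSC surgery and edge-cone
metrics (Riemannian geometry); the recognition half is imported unchanged from BachCriticalElement.
Negatives index: empty at filing.

RANKED CRUXES. #2 PscBranchLink (crux) — every smooth homotopy 4-sphere M (summit binder) admits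
2-knots K : Fin m → TwoKnot with pairwise disjoint tubular neighbourhoods ν i, a smooth map p : M →
S⁴ and smooth embeddings σ i : S²×ℝ² → M with p (σ i (x,w)) = ν i (x, w²) (complex square) such that
every point of M is a local-diffeomorphism point of p or lies on some σ i — a branched cover of S⁴
in sphere-link normal form — AND the sphere-link surgery manifold N (open gluing of S⁴ ∖ ⋃ range (K
i) with ⊔_i B̊³×S¹ along ν i (x, t·u) ~ (c_i + t·x, u), 0 < t < 1) carries a Riemannian metric with
Levi-Civita connection and everywhere positive scalar curvature (card K1 = COV-PSC). [deps:
SphereBranchLink] [difficulty: open-problem] (why it might fail: χ(B)=2d−2 still allows closed torus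
components; removing them by covering moves may force components K whose surgery piece M_K has no
PSC (aspherical fibred 2-knots; LRS-obstructed homology S¹×S³), collapsing the statement to "Σ is a
presentation sphere" or refuting it.) [doi:10.2140/gt.2002.6.393, arXiv:1602.07459,
arXiv:2605.26337, arXiv:1702.04417, GromovLawson1980, BamlerKleiner2019]
#3 PscSpheresStandard (crux) — every smooth homotopy 4-sphere (summit binder) carrying a Riemannian
metric with Levi-Civita connection and everywhere positive scalar curvature is diffeomorphic to S⁴
(card K2; the target X₁ of route BachCriticalElement, identical decl text, shared item; engines
there: CGY 16π²χ Weyl threshold, Weyl-energy critical element). [difficulty: open-problem] (why it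
might fail: it is SPC4 on Yamabe-positive spheres — false iff an exotic homotopy 4-sphere carries
PSC; PSC is scale-free, so a fake 4-ball can hide below every curvature scale (card appendix-lemma)
and no recognition engine beyond CGY's ∫|W|² < 16π²χ threshold is known.) [ChangGurskyYang2003,
KumarSen2025, SchoenYau1979]
#4 SphereBranchLink (crux) — the curvature-free half of PscBranchLink: every smooth homotopy
4-sphere is a branched cover of S⁴ in sphere-link normal form (data K, ν, p, σ as above), i.e. a
simple-type cover of S⁴ whose branch locus consists of embedded 2-spheres only (card
branched-cover-surface-links crux 4; Kirby Problem 4.113). Refuting it refutes PscBranchLink;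
proving it isolates the curvature question on 2-links. [difficulty: open-problem] (why it might
fail: Iori–Piergallini / Piergallini–Zuddas / Bais–Piergallini–Zuddas control embeddedness and
degree, never genus: Riemann–Hurwitz leaves d−1 spheres plus closed tori, and no covering move
trading a torus for sheets at fixed M is known (cf. the irremovable cone point of 3-fold covers,
BCKM 2024).) [doi:10.2140/gt.2002.6.393, arXiv:1602.07459, arXiv:2605.26337, arXiv:1909.11788,
Kirby1997]
#9 ConeAbsorption (support) — CONE ABSORPTION (card P1, provable now): for every M in the summit
binder (no homotopy hypothesis, compactness not needed) and every sphere-link normal-form datum (K,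
ν, p, σ) on M, if the surgery manifold N of (K, ν) carries a PSC metric g_N then M carries a PSC
metric. Proof route: (1) the core circles C_i = jB({c_i}×S¹) ⊂ N come with the tubes λ_i(u,y) =
jB(c_i+y,u); make dλ_i g_N-orthonormal along C_i by an isotopy (S¹ → upper-triangular⁺ is
null-homotopic) and make λ_i the g_N-exponential tube on a small disc bundle (tubular uniqueness rel
1-jet, Hirsch 4.5.3 / Kosinski III), pulling g_N back — still PSC; (2) Gromov–Lawson surgery on the
C_i (codimension 3) in the framing class of λ_i (the untwisting path of the normal holonomy in SO(3)
realises either class of π₁SO(3) = ℤ/2) with final frame dλ_i: the surgered manifold N' carries a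
PSC metric equal on each handle D̊²×S² to g_D(w) ⊕ δ²·round, g_D rotationally symmetric, flat on |w|
< a, a > 0 fixed by (N, g_N, λ), δ → 0 free (handle form: arXiv:0811.0325); (3) surgery along λ_i
exactly undoes the sphere surgery: N' ≅ S⁴ by the identity off B and the coordinate swap ν_i(x,w) ↔
(w,x) on the tubes, so S⁴ gets a PSC metric g with ν_i*g = δ²·round ⊕ g_D — a product in the GIVEN
liftable tubes; (4) on M take p*g off ⋃σ_i(S²×D̄(½√a')) and on the σ-tubes δ²·round ⊕ (smoothing of
the 4π cone (w ↦ w²)*g_D = dr² + 4r²dα²) by a rotationally symmetric profile with Gauss curvature ≥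
−(1−η)/δ², which exists once a ≫ δ² … precisely once the flat radius dominates δ (Gauss–Bonnet
budget −2π, overshoot slope 2 and return with K > 0, refuter-checked on the card); scal = 2/δ² + 2K
> 0 there and scal∘p > 0 elsewhere. [difficulty: provable-now] [GromovLawson1980, arXiv:0811.0325,
Hirsch1976, Kosinski1993, arXiv:1203.6389]

TWO-LAYER PLAN. Foreseen glued splits (filed by `route edit --split` in tenure, not now). (a)
PscBranchLink ⇐ RibbonDiscExtension → RibbonLinkSurgeryPsc →
PscBranchLink: RibbonDiscExtension = "for a homotopy 4-sphere M and d ≥ 5, the (d−1)-unlink cover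
∂(M ∖ B̊⁴) = S³ → S³ extends over
M ∖ B̊⁴ → B⁴ as a simple cover branched over d−1 RIBBON DISCS (no closed components)" — the
Bais–Piergallini–Zuddas scheme
(arXiv:2605.26337 Thm 4.2 with N = S⁴) where Riemann–Hurwitz forces discs as soon as closed
components are absent, so B is a ribbon
sphere-link; RibbonLinkSurgeryPsc = "the surgery manifold of a ribbon sphere-link is ∂(5-dimensional
2-handlebody), hence PSC by
Gromov–Lawson (surgeries of codimension 3 and 4 on round S⁴)" (provable now). This branch makes M a
presentation sphere, i.e. it meets
RicciTranscript.PresentationSphere; the slack of PscBranchLink beyond it is branch components that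
are fibred with spherical-space-form or

KILL CRITERIA. SphereBranchLink refuted (a homotopy 4-sphere with no all-sphere simple-type branched
presentation) ⇒ PscBranchLink is false too: close
`refuted:SphereBranchLink` (the card survives only as the support lemma ConeAbsorption, worth
landing as Literature). PscBranchLink refuted
with SphereBranchLink intact (some Σ all of whose sphere-link presentations have a component with
non-PSC surgery piece) ⇒ close
`refuted:PscBranchLink` unless the witness Σ is shown standard (then the refutation is of the
presentation, record it and pivot to branch
(a), the ribbon/presentation-sphere form, explicitly CONDITIONAL on
RicciTranscript.PresentationSphere). PscSpheresStandard refuted = an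
exotic PSC homotopy sphere = ¬SPC4: the problem closes negatively (same kill as BachCriticalElement
/ PIC). ConeAbsorption refuted would be
an error in the differential geometry (tube matching or cone smoothing): the route loses its
mechanism — close `refuted:ConeAbsorption`.
SPC4 or PscOnHomotopySpheres proved elsewhere moots PscBranchLink's role (the route then only shares
X₁).

NOT DECOMPOSED YET. The covering-move calculus needed for SphereBranchLink (torus trading, sheet
stabilisation d ↦ d+1; layer-2 children); the component-wise
PSC test for 2-knot surgery pieces M_K (fibred case: PSC iff the closed-fibre bundle carries PSC;
LRS obstruction λ_SW + h on spin
rational homology S¹×S³; Hanke–Pape–Schick codimension-2 index obstructions do not bite at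
π₁(S⁴∖B)-level here) — filed as ¬-items or
supports only when a concrete Σ is on the table; the ribbon branch (a) and its converse
"presentation spheres are covers along ribbon
sphere-links" (5-dimensional Montesinos, conjectural); RP²(ε) branch components (work by the same
computation on the orientation cover)
and torus components (do NOT work: no curvature reservoir) — remarks, not items; the explicit
two-parameter smoothing profile (a prover's
lemma under ConeAbsorption via --supports); definitions that would shorten the three long items (see
Definition requests).

CHEAPEST FALSIFIER. (i) One page of warped-product algebra decides the cone smoothing inside
ConeAbsorption: on S²(δ) × (disc, dr² + φ(r)²dα²) scal =
2/δ² − 2φ''/φ, the cone dr² + 4r²dα² must be met with φ' = 2, and Gauss–Bonnet fixes ∫K dA =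
2π(φ'(0) − 2) = −2π; with K ≥ −1/(4δ²)
one needs smoothing area ≥ 8πδ², available inside a flat disc of radius a ≥ 3δ (overshoot slope 2,
return with K > 0) — run by the
card's refuter (2026-08-15): passes with room. (ii) Tube bookkeeping (this seat): circle surgery on
N along λ_i(u,y) = jB(c_i+y,u) returns S⁴ with handle coordinates =
the given tubes ν_i swapped (no liftability issue); framing class and 1-jet are both adjustable
(π₁SO(3) via the untwisting path;
triangular⁺ loops null-homotopic) — no obstruction found. (iii) Literature: a printed "PSC lifts to
branched covers along small 2-spheres" lemma would
downgrade ConeAbsorption to known (zbMATH / arXiv / galaxy 2026-08-15: not found); no printed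
homotopy-4-sphere presentation with every
sphere-link branch locus obstructed exists either (the explicit ones — Gordon's and Pao's cyclic
covers of twist-spun knots — are
standard with PSC surgery pieces).

NUMBERS. Riemann–Hurwitz in normal form: χ(M) = d·χ(S⁴) − Σ_j (e_j − 1)χ(R_j) = 2d − 2m for m
index-2 ramification spheres, so a homotopy
sphere presented with d sheets has exactly m = d − 1 branch spheres (d = 2: one 2-knot, M = its
double branched cover, N = M_K;
Iori–Piergallini d = 5: four spheres if no torus components). General embedded branch surface:
Σ_components (1 − g − k/2) = d − 1,
so ≥ d − 1 sphere components always, equality iff the rest are tori/Klein bottles. Cone angle along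
R_j: 4π; Gauss–Bonnet deficit
−2π per normal disc; product scalar curvature 2/δ² + 2K_D > 0 iff K_D > −1/δ²; GL handle: flat
normal radius a bounded by the
core-circle geometry of N, sphere radius δ → 0 free. K3 check: χ = 24 forces χ(B) = 2d − 24 < 0 at d
= 5 (genus forced, lemma silent,
consistent with Lichnerowicz). Items at open: 5 (3 cruxes, 1 support, assembly).

DEFINITION REQUESTS. None filed now — every item elaborates over existing declarations
(Literature.Topology.FourManifolds.TwoKnot, IsOpenGluing — the tubular-neighbourhood
datum is inlined since rev 2 (cone repair: `TwoKnot.TubularNbhd` lives in GluckTwist.lean, whose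
module carries the unproved
Freedman-dependent fact nonempty_homeomorph_sphere_of_isGluckTwist, so that import is dropped; a
prover repackages ⟨ν i, hν i, hν0 i⟩
as a `TwoKnot.TubularNbhd` inside a Theorems file when the Gluck-twist API is wanted);
Literature.Geometry.Lorentzian.PseudoRiemannianMetric, HasLeviCivita, scalarCurvature; Mathlib
IsLocalDiffeomorphAt,
Manifold.IsSmoothEmbedding). Two notions WOULD shorten the items and serve card
branched-cover-surface-links as well, to be requested by
the tenure planner if a second route needs them: `IsBranchedAlongSphereLink p K ν σ` (the
normal-form clause, topic
Literature/Topology/FourManifolds) and `IsSphereLinkSurgery K ν N` (the open-gluing clause). The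
simple-branched-cover notion
`IsSimpleBranchedCover d X S⁴ B` asked for by card branched-cover-surface-links is deliberately NOT
used: local chart models do not yield
liftable tubes (the square root of a non-holomorphic tube change is not smooth), and ConeAbsorption
needs the product metric in a
liftable tube; the global normal form is equivalent up to diffeomorphism of M and is what the lemma
consumes. Bib entries wanted (lit
cite when the gate is up): doi:10.2140/gt.2002.6.393 (Iori–Piergallini 2002), arXiv:1602.07459
(Piergallini–Zuddas 2019),
arXiv:2605.26337 (Bais–Piergallini–Zuddas 2026), arXiv:1702.04417 (Lin–Ruberman–Saveliev 2018),
arXiv:1203.6389 (Atiyah–LeBrun 2013),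
arXiv:0811.1245 (Walsh 2011, Mem. AMS 983), arXiv:1909.11788 (Blair–Cahn–Kjuchukova–Meier 2024).

Novelty: Searches (2026-08-15, this seat; searchd intermittently down, OpenAlex budget exhausted): `lit
search --source zbmath "branched covering
scalar curvature"` (3: Arezzo–Della Vedova–Shi cscK on ramified Galois covers arXiv:2110.01222,
Honda, a proceedings volume — none lifts
PSC); `lit search --source arxiv "positive scalar curvature branched cover"` (3: Gong
arXiv:2310.02552 spectral-sequence cobordisms,
Baraglia arXiv:2410.10033 SW constraints on embedded spheres, Honda — none a lifting lemma; this is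
the arXiv search the card still owed);
`lit search --source zbmath "4-manifolds covers of the 4-sphere branched over surfaces"`
(Iori–Piergallini doi:10.2140/gt.2002.6.393);
`lit galaxy search --star all` ×6 ("branched covering positive scalar curvature", "branched over
non-singular surfaces", "scalar curvature
of branched covers", "branched cover of the 4-sphere", "positive scalar curvature metrics on
branched", "branched cover": 0 relevant);
`lit galaxy search --star pdf --mode intelligent "lifting positive scalar curvature metrics to
branched covers along codimension two
submanifolds, cone angle 4π, Gromov–Lawson surgery"` (10: nearest Hanke–Pape–Schick AIF 65 (2015)
codimension-2 INDEX OBSTRUCTIONS —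
opposite direction, needs π₁; Tang–Xie–Yan arXiv:1107.5234 isoparametric GL theory; rest
irrelevant); `lit frontier SmoothPoincare4
--since 2023` (30 rows; row 14 = Bais–Piergallini–Zuddas arXiv:2605.26337, READ pp.1–5, 11–18:
lattice criterion for d-fold covers
M → N, Thm 4.2 r  [refs: 10.2140/gt.2002.6.393, 2110.01222, 2310.02552, 2410.10033, 1107.5234, 2605.26337, 1602.07459, 1909.11788, 1203.6389, doi:10.2140/gt.2002.6.393, GromovLawson1980]

Barriers (technique_class: psc-branched-cover, gromov-lawson-codim3, 2-link-surgery): - technique_class: psc-branched-cover, gromov-lawson-codim3, 2-link-surgery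
- Literature.Barriers.SmoothPoincare4.GaugeSumBarrierFour: not engaged — no Donaldson/Seiberg–Witten
invariant of Σ (blind at b⁺ = 0) is computed; gauge theory enters only as the POLICE on the
3+1-dimensional surgery pieces M_K ⊂ standard S⁴ (LRS λ_SW + h, b₁ = 1), where it is alive.
- Literature.Barriers.SmoothPoincare4.TopologicalBarrierFour: does not apply — "Σ branches over a
PSC-surgerable sphere-link" is a statement about smooth presentations, never read off
homotopy-invariant data; the diffeomorphism comes from PscSpheresStandard.
- Literature.Barriers.SmoothPoincare4.StableBarrierFour: does not apply — nothing is stabilised; #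
S²×S² changes χ and destroys the all-sphere count χ(B) = 2d − 2.
- Literature.Barriers.SmoothPoincare4.HCobordismInvariantBarrierFour: does not apply — no
h-cobordism-invariant detector is used.
- Literature.Barriers.SmoothPoincare4.HCobordismBarrierFour: not engaged — no h-cobordism step;
recognition is X₁'s business (conformal/Weyl route).
- Literature.Barriers.SmoothPoincare4.TwistedSphereBarrierFour: not engaged — Σ is never written as
a twisted sphere.
- Literature.Barriers.SmoothPoincare4.CircleActionBarrierFour: consistent — covers with
spun/symmetric branch data (Pao, Gordon) give standard Σ, and their surgery pieces are PSC
trivially; the route never constructs exotica.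
- Literature.Barriers.SmoothPoincare4.CappellShanesonFamilyBarrier: consistent — Cappell–Shan

History (route lifecycle, newest last):
- 2026-08-15T20:13:28Z · rev 2: restated PscBranchLink (stmt-SmoothPoincare4-14808), SphereBranchLink (stmt-SmoothPoincare4-14809), ConeAbsorption (stmt-SmoothPoincare4-14810) — route-repair (cone, priority guardrail): import Literature.Topology.FourManifolds.GluckTwist DROPPED — it was imported only for the structure TwoKnot.TubularNbh (planner-rrepair-SmoothPoincare4-SmallBranchSph-61bceef9-0)
- 2026-08-15T20:16:58Z · rev 3: restated PscBranchLink (stmt-SmoothPoincare4-13705), SphereBranchLink (stmt-SmoothPoincare4-13706), ConeAbsorption (stmt-SmoothPoincare4-13707) — route-repair follow-up (rev 3): FIX of the rev-2 restate — in the disjointness clause the mechanical rewrite `(ν i).toFun ↦ ν i` produced `Disjoint (Set.range ν (planner-rrepair-SmoothPoincare4-SmallBranchSph-61bceef9-0)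
- 2026-08-22T16:32:18Z · DORMANT — reconciler: no traction for 5.5 d (last activity item-evidence-added at 2026-08-17T04:17:11Z); parked, not closed — `ledger route dormant route-SmoothPoincare4- (operator:999:2302702)

sub-problem: SmoothPoincare4 · status: dormant · opened planner-plancard-SmoothPoincare4-SmoothPoinca-243adcaa-0 2026-08-15T19:12:24Z · rev 3 · ledger route-SmoothPoincare4-SmallBranchSpheres
GENERATED by the gate from the ledger (D-0016/17). Provers cite these decls: `theorem foo : Summit.SmoothPoincare4.SmoothPoincare4.Theses.SmallBranchSpheres.<Decl> := …` in Summits/SmoothPoincare4/SmoothPoincare4/Theorems/<Name>.lean.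
-/

namespace Summit.SmoothPoincare4.SmoothPoincare4.Theses.SmallBranchSpheres

open scoped BigOperators Topology Manifold Classical MeasureTheory ProbabilityTheory Matrix InnerProductSpace ComplexConjugate ContinuousMap ContDiff
open Filter Set Function TopologicalSpace MeasureTheory

attribute [summit_statement] _root_.SmoothPoincare4

open Literature.SPC4

-- earlier PscBranchLink (stmt-SmoothPoincare4-13705, replaced 2026-08-15T20:16:58Z -> stmt-SmoothPoincare4-13724): retired by None — ∀ (M : Type) [TopologicalSpace M] [T2Space M] [SecondCountableTopology M] [ChartedSpace (EuclideanSpace ℝ (Fin 4)) M] [IsManifold (𝓡 4) ∞ M], M ≃ₕ Metric.sphere (0 : EuclideanSpace ℝ (Fin 5)) 1 → ∃ (m : ℕ) (K : Fin m → Literature.Topology.FourManifolds.TwoKnot) (ν : Fi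
-- earlier PscBranchLink (stmt-SmoothPoincare4-14808, replaced 2026-08-15T20:13:28Z -> stmt-SmoothPoincare4-13705): retired by None — ∀ (M : Type) [TopologicalSpace M] [T2Space M] [SecondCountableTopology M] [ChartedSpace (EuclideanSpace ℝ (Fin 4)) M] [IsManifold (𝓡 4) ∞ M], M ≃ₕ Metric.sphere (0 : EuclideanSpace ℝ (Fin 5)) 1 → ∃ (m : ℕ) (K : Fin m → Literature.Topology.FourManifolds.TwoKnot) (ν : ∀ 
/-- item stmt-SmoothPoincare4-13724 · crux · rank 2 · open · by planner
why it might fail: χ(B)=2d−2 still allows closed torus components; removing them by covering moves may force components K whose surgery piece M_K has no PSC (aspherical fibred 2-knots; LRS-obstructed homology S¹×S³), collapsing the statement to "Σ is a presentation sphere" or refuting it.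
sources: IoriPiergallini2002, PiergalliniZuddas2016, BaisPiergalliniZuddas2026, LinRubermanSaveliev2017, GromovLawson1980, BamlerKleiner2019
[crux] every smooth homotopy 4-sphere M (summit binder) admits 2-knots K : Fin m → TwoKnot, tube
maps ν i : S²×ℝ² → S⁴ that are smooth embeddings with ν i (x,0) = K i x and pairwise disjoint
ranges, a smooth map p : M → S⁴ and smooth embeddings σ i : S²×ℝ² → M with p (σ i (x,w)) = ν i (x,
w²) (complex square) such that every point of M is a local-diffeomorphism point of p or lies on some
σ i — a branched cover of S⁴ in sphere-link normal form — AND the sphere-link surgery manifold N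
(open gluing of S⁴ ∖ ⋃ range (K i) with ⊔_i B̊³×S¹ along ν i (x, t·u) ~ (c_i + t·x, u), 0 < t < 1,
c_i = (3i,0,0)) carries a Riemannian metric with Levi-Civita connection and everywhere positive
scalar curvature (card K1 = COV-PSC). Rev 2 (cone repair 2026-08-15): the tube datum is inlined — ν
i : S²×ℝ² → S⁴ a smooth embedding with ν i (x,0) = K i x, clauses carried inside the normal-form
conjunction — instead of the packaged `TwoKnot.TubularNbhd ⇑(K i)` of GluckTwist.lean; mathematical
content unchanged. [deps: SphereBranchLink] [difficulty: open-problem] -/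
@[route_item "route-SmoothPoincare4-SmallBranchSpheres", crux]
def PscBranchLink : Prop :=
  ∀ (M : Type) [TopologicalSpace M] [T2Space M] [SecondCountableTopology M] [ChartedSpace (EuclideanSpace ℝ (Fin 4)) M] [IsManifold (𝓡 4) ∞ M], M ≃ₕ Metric.sphere (0 : EuclideanSpace ℝ (Fin 5)) 1 → ∃ (m : ℕ) (K : Fin m → Literature.Topology.FourManifolds.TwoKnot) (ν : Fin m → (Metric.sphere (0 : EuclideanSpace ℝ (Fin 3)) 1) × EuclideanSpace ℝ (Fin 2) → Metric.sphere (0 : EuclideanSpace ℝ (Fin 5)) 1) (p : M → Metric.sphere (0 : EuclideanSpace ℝ (Fin 5)) 1) (σ : Fin m → (Metric.sphere (0 : EuclideanSpace ℝ (Fin 3)) 1) × EuclideanSpace ℝ (Fin 2) → M), (ContMDiff (𝓡 4) (𝓡 4) ∞ p ∧ (∀ i, Manifold.IsSmoothEmbedding ((𝓡 2).prod 𝓘(ℝ, EuclideanSpace ℝ (Fin 2))) (𝓡 4) ∞ (ν i)) ∧ (∀ i (x : Metric.sphere (0 : EuclideanSpace ℝ (Fin 3)) 1), ν i (x, 0)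 = (K i) x) ∧ (∀ i j : Fin m, i ≠ j → Disjoint (Set.range (ν i)) (Set.range (ν j))) ∧ (∀ i, Manifold.IsSmoothEmbedding ((𝓡 2).prod 𝓘(ℝ, EuclideanSpace ℝ (Fin 2))) (𝓡 4) ∞ (σ i)) ∧ (∀ i x (w : EuclideanSpace ℝ (Fin 2)), p (σ i (x, w)) = ν i (x, (WithLp.toLp 2 ![w 0 ^ 2 - w 1 ^ 2, 2 * w 0 * w 1] : EuclideanSpace ℝ (Fin 2)))) ∧ (∀ y, IsLocalDiffeomorphAt (𝓡 4) (𝓡 4) ∞ p y ∨ ∃ i x w, y = σ i (x, w))) ∧ ∃ (N : Type) (_ : TopologicalSpace N) (_ : T2Space N) (_ : SecondCountableTopology N) (_ : CompactSpace N) (_ : ChartedSpace (EuclideanSpace ℝ (Fin 4)) N) (_ : IsManifold (𝓡 4) ∞ N), Literature.Topology.FourManifolds.IsOpenGluing (𝓡 4) (𝓘(ℝ, EuclideanSpace ℝ (Fin 3)).prod (𝓡 1)) (𝓡 4) (A := ↥(⟨(⋃ i, Set.range ⇑(K i))ᶜ, (isClosed_iUnion_of_finite fun i => (K i).isClosed_range).isOpen_compl⟩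 : TopologicalSpace.Opens (Metric.sphere (0 : EuclideanSpace ℝ (Fin 5)) 1))) (B := ↥(⟨⋃ i : Fin m, Prod.fst ⁻¹' Metric.ball (WithLp.toLp 2 ![(3 * (i : ℕ) : ℝ), 0, 0] : EuclideanSpace ℝ (Fin 3)) 1, isOpen_iUnion fun _ => Metric.isOpen_ball.preimage continuous_fst⟩ : TopologicalSpace.Opens ((EuclideanSpace ℝ (Fin 3)) × Metric.sphere (0 : EuclideanSpace ℝ (Fin 2)) 1))) (P := N) (fun a b => ∃ (i : Fin m) (x : Metric.sphere (0 : EuclideanSpace ℝ (Fin 3)) 1) (u : Metric.sphere (0 : EuclideanSpace ℝ (Fin 2)) 1) (t : ℝ), t ∈ Set.Ioo (0 : ℝ) 1 ∧ (b : (EuclideanSpace ℝ (Fin 3)) × Metric.sphere (0 : EuclideanSpace ℝ (Fin 2)) 1).1 = (WithLp.toLp 2 ![(3 * (i : ℕ) : ℝ), 0, 0] : EuclideanSpace ℝ (Fin 3)) + t • (x : EuclideanSpace ℝ (Fin 3)) ∧ (b : (EuclideanSpace ℝ (Fin 3)) × Metric.sphere (0 : EuclideanSpace ℝ (Fin 2))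 1).2 = u ∧ (a : Metric.sphere (0 : EuclideanSpace ℝ (Fin 5)) 1) = ν i (x, t • (u : EuclideanSpace ℝ (Fin 2)))) ∧ ∃ g : Literature.Geometry.Lorentzian.PseudoRiemannianMetric (𝓡 4) ∞ (EuclideanSpace ℝ (Fin 4)) (TangentSpace (𝓡 4) : N → Type _), ∃ _ : g.HasLeviCivita, g.IsRiemannian ∧ ∀ x, 0 < g.scalarCurvature x

/-- item stmt-SmoothPoincare4-4393 · crux · rank 3 · open · by planner
why it might fail: it is SPC4 on Yamabe-positive spheres — false iff an exotic homotopy 4-sphere carries PSC; PSC is scale-free, so a fake 4-ball can hide below every curvature scale (card appendix-lemma) and no recognition engine beyond CGY's ∫|W|² < 16π²χ threshold is known.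
sources: ChangGurskyYang2003, KumarSen2025, SchoenYau1979
[target] every smooth homotopy 4-sphere (summit binder: T2, second countable, C^∞ atlas on ℝ⁴, M ≃ₕ
S⁴) carrying a Riemannian metric with a Levi-Civita connection and everywhere positive scalar
curvature is diffeomorphic to S⁴ — the deliverable X₁ of the critical-element programme (card cruxes
E + R), the node that the two-layer plan splits into WeylInfimumAttained → WeylMinimiserRigidity
once weylEnergy lands. [deps: EinsteinRigidity, PscOnHomotopySpheres] [difficulty: open-problem] -/
@[route_item "route-SmoothPoincare4-SmallBranchSpheres", crux]
def PscSpheresStandard : Prop :=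
  ∀ (M : Type) [TopologicalSpace M] [T2Space M] [SecondCountableTopology M] [ChartedSpace (EuclideanSpace ℝ (Fin 4)) M] [IsManifold (𝓡 4) ∞ M], M ≃ₕ Metric.sphere (0 : EuclideanSpace ℝ (Fin 5)) 1 → (∃ g : Literature.Geometry.Lorentzian.PseudoRiemannianMetric (𝓡 4) ∞ (EuclideanSpace ℝ (Fin 4)) (TangentSpace (𝓡 4) : M → Type _), ∃ _ : g.HasLeviCivita, g.IsRiemannian ∧ ∀ x, 0 < g.scalarCurvature x) → Nonempty (M ≃ₘ⟮𝓡 4, 𝓡 4⟯ Metric.sphere (0 : EuclideanSpace ℝ (Fin 5)) 1)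

-- earlier SphereBranchLink (stmt-SmoothPoincare4-13706, replaced 2026-08-15T20:16:58Z -> stmt-SmoothPoincare4-13725): retired by None — ∀ (M : Type) [TopologicalSpace M] [T2Space M] [SecondCountableTopology M] [ChartedSpace (EuclideanSpace ℝ (Fin 4)) M] [IsManifold (𝓡 4) ∞ M], M ≃ₕ Metric.sphere (0 : EuclideanSpace ℝ (Fin 5)) 1 → ∃ (m : ℕ) (K : Fin m → Literature.Topology.FourManifolds.TwoKnot) (ν :
-- earlier SphereBranchLink (stmt-SmoothPoincare4-14809, replaced 2026-08-15T20:13:28Z -> stmt-SmoothPoincare4-13706): retired by None — ∀ (M : Type) [TopologicalSpace M] [T2Space M] [SecondCountableTopology M] [ChartedSpace (EuclideanSpace ℝ (Fin 4)) M] [IsManifold (𝓡 4) ∞ M], M ≃ₕ Metric.sphere (0 : EuclideanSpace ℝ (Fin 5)) 1 → ∃ (m : ℕ) (K : Fin m → Literature.Topology.FourManifolds.TwoKnot) (ν :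
/-- item stmt-SmoothPoincare4-13725 · crux · rank 4 · open · by planner
why it might fail: Iori–Piergallini / Piergallini–Zuddas / Bais–Piergallini–Zuddas control embeddedness and degree, never genus: Riemann–Hurwitz leaves d−1 spheres plus closed tori, and no covering move trading a torus for sheets at fixed M is known (cf. the irremovable cone point of 3-fold covers, BCKM 2024).
sources: IoriPiergallini2002, PiergalliniZuddas2016, BaisPiergalliniZuddas2026, BlairEtAl2019, Kirby1997
[crux] the curvature-free half of PscBranchLink: every smooth homotopy 4-sphere is a branched cover
of S⁴ in sphere-link normal form (data K, ν, p, σ as in PscBranchLink: 2-knots K i, tube maps ν i :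
S²×ℝ² → S⁴ smooth embeddings with ν i (x,0) = K i x and pairwise disjoint ranges, p : M → S⁴ smooth,
σ i : S²×ℝ² → M smooth embeddings with p (σ i (x,w)) = ν i (x, w²), every point of M a
local-diffeomorphism point of p or on a σ-tube), i.e. a simple-type cover of S⁴ whose branch locus
consists of embedded 2-spheres only (card branched-cover-surface-links crux 4; Kirby Problem 4.113).
Refuting it refutes PscBranchLink; proving it isolates the curvature question on 2-links. Rev 2
(cone repair 2026-08-15): the tube datum is inlined — ν i : S²×ℝ² → S⁴ a smooth embedding with ν i
(x,0) = K i x, clauses carried inside the normal-form conjunction — instead of the packaged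
`TwoKnot.TubularNbhd ⇑(K i)` of GluckTwist.lean; mathematical content unchanged. [difficulty:
open-problem] -/
@[route_item "route-SmoothPoincare4-SmallBranchSpheres"]
def SphereBranchLink : Prop :=
  ∀ (M : Type) [TopologicalSpace M] [T2Space M] [SecondCountableTopology M] [ChartedSpace (EuclideanSpace ℝ (Fin 4)) M] [IsManifold (𝓡 4) ∞ M], M ≃ₕ Metric.sphere (0 : EuclideanSpace ℝ (Fin 5)) 1 → ∃ (m : ℕ) (K : Fin m → Literature.Topology.FourManifolds.TwoKnot) (ν : Fin m → (Metric.sphere (0 : EuclideanSpace ℝ (Fin 3)) 1) × EuclideanSpace ℝ (Fin 2) → Metric.sphere (0 : EuclideanSpace ℝ (Fin 5)) 1) (p : M → Metric.sphere (0 : EuclideanSpace ℝ (Fin 5)) 1) (σ : Fin m → (Metric.sphere (0 : EuclideanSpace ℝ (Fin 3)) 1) × EuclideanSpace ℝ (Fin 2) → M), ContMDiff (𝓡 4) (𝓡 4) ∞ p ∧ (∀ i, Manifold.IsSmoothEmbedding ((𝓡 2).prod 𝓘(ℝ, EuclideanSpace ℝ (Fin 2))) (𝓡 4) ∞ (ν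 i)) ∧ (∀ i (x : Metric.sphere (0 : EuclideanSpace ℝ (Fin 3)) 1), ν i (x, 0) = (K i) x) ∧ (∀ i j : Fin m, i ≠ j → Disjoint (Set.range (ν i)) (Set.range (ν j))) ∧ (∀ i, Manifold.IsSmoothEmbedding ((𝓡 2).prod 𝓘(ℝ, EuclideanSpace ℝ (Fin 2))) (𝓡 4) ∞ (σ i)) ∧ (∀ i x (w : EuclideanSpace ℝ (Fin 2)), p (σ i (x, w)) = ν i (x, (WithLp.toLp 2 ![w 0 ^ 2 - w 1 ^ 2, 2 * w 0 * w 1] : EuclideanSpace ℝ (Fin 2)))) ∧ (∀ y, IsLocalDiffeomorphAt (𝓡 4) (𝓡 4) ∞ p y ∨ ∃ i x w, y = σ i (x, w))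

-- earlier ConeAbsorption (stmt-SmoothPoincare4-13707, replaced 2026-08-15T20:16:58Z -> stmt-SmoothPoincare4-13726): retired by None — ∀ (M : Type) [TopologicalSpace M] [T2Space M] [SecondCountableTopology M] [ChartedSpace (EuclideanSpace ℝ (Fin 4)) M] [IsManifold (𝓡 4) ∞ M], ∀ (m : ℕ) (K : Fin m → Literature.Topology.FourManifolds.TwoKnot) (ν : Fin m → (Metric.sphere (0 : EuclideanSpace ℝ (Fin 3)) 1
-- earlier ConeAbsorption (stmt-SmoothPoincare4-14810, replaced 2026-08-15T20:13:28Z -> stmt-SmoothPoincare4-13707): retired by None — ∀ (M : Type) [TopologicalSpace M] [T2Space M] [SecondCountableTopology M] [ChartedSpace (EuclideanSpace ℝ (Fin 4)) M] [IsManifold (𝓡 4) ∞ M], ∀ (m : ℕ) (K : Fin m → Literature.Topology.FourManifolds.TwoKnot) (ν : ∀ i, Literature.Topology.FourManifolds.TwoKnot.TubularN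
/-- item stmt-SmoothPoincare4-13726 · support · rank 9 · open · by planner
sources: GromovLawson1980, Walsh2010, Hirsch1976, Kosinski1993, AtiyahLebrun2012
[support] CONE ABSORPTION (card P1, provable now): for every M in the summit binder (no homotopy
hypothesis, compactness not needed) and every sphere-link normal-form datum (K, ν, p, σ) on M, if
the surgery manifold N of (K, ν) carries a PSC metric g_N then M carries a PSC metric. Proof route:
(1) the core circles C_i = jB({c_i}×S¹) ⊂ N come with the tubes λ_i(u,y) = jB(c_i+y,u); make dλ_i
g_N-orthonormal along C_i by an isotopy (S¹ → upper-triangular⁺ is null-homotopic) and make λ_i the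
g_N-exponential tube on a small disc bundle (tubular uniqueness rel 1-jet, Hirsch 4.5.3 / Kosinski
III), pulling g_N back — still PSC; (2) Gromov–Lawson surgery on the C_i (codimension 3) in the
framing class of λ_i (the untwisting path of the normal holonomy in SO(3) realises either class of
π₁SO(3) = ℤ/2) with final frame dλ_i: the surgered manifold N' carries a PSC metric equal on each
handle D̊²×S² to g_D(w) ⊕ δ²·round, g_D rotationally symmetric, flat on |w| < a, a > 0 fixed by (N,
g_N, λ), δ → 0 free (handle form: Walsh2010 = arXiv:0811.1245); (3) surgery along λ_i exactly undoes
the sphere surgery: N' ≅ S⁴ by the identity off B and the coordinate swap ν_i(x,w) ↔ (w,x) on the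
tubes, so S⁴ get -/
@[route_item "route-SmoothPoincare4-SmallBranchSpheres", crux]
def ConeAbsorption : Prop :=
  ∀ (M : Type) [TopologicalSpace M] [T2Space M] [SecondCountableTopology M] [ChartedSpace (EuclideanSpace ℝ (Fin 4)) M] [IsManifold (𝓡 4) ∞ M], ∀ (m : ℕ) (K : Fin m → Literature.Topology.FourManifolds.TwoKnot) (ν : Fin m → (Metric.sphere (0 : EuclideanSpace ℝ (Fin 3)) 1) × EuclideanSpace ℝ (Fin 2) → Metric.sphere (0 : EuclideanSpace ℝ (Fin 5)) 1) (p : M → Metric.sphere (0 : EuclideanSpace ℝ (Fin 5)) 1) (σ : Fin m → (Metric.sphere (0 : EuclideanSpace ℝ (Fin 3)) 1) × EuclideanSpace ℝ (Fin 2) → M), (ContMDiff (𝓡 4) (𝓡 4) ∞ p ∧ (∀ i, Manifold.IsSmoothEmbedding ((𝓡 2).prod 𝓘(ℝ, EuclideanSpace ℝ (Fin 2))) (𝓡 4) ∞ (ν i)) ∧ (∀ i (x : Metric.sphere (0 : EuclideanSpace ℝ (Fin 3)) 1), ν i (x, 0) = (K i) x) ∧ (∀ i j : Fin m, i ≠ j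 → Disjoint (Set.range (ν i)) (Set.range (ν j))) ∧ (∀ i, Manifold.IsSmoothEmbedding ((𝓡 2).prod 𝓘(ℝ, EuclideanSpace ℝ (Fin 2))) (𝓡 4) ∞ (σ i)) ∧ (∀ i x (w : EuclideanSpace ℝ (Fin 2)), p (σ i (x, w)) = ν i (x, (WithLp.toLp 2 ![w 0 ^ 2 - w 1 ^ 2, 2 * w 0 * w 1] : EuclideanSpace ℝ (Fin 2)))) ∧ (∀ y, IsLocalDiffeomorphAt (𝓡 4) (𝓡 4) ∞ p y ∨ ∃ i x w, y = σ i (x, w))) → (∃ (N : Type) (_ : TopologicalSpace N) (_ : T2Space N) (_ : SecondCountableTopology N) (_ : CompactSpace N) (_ : ChartedSpace (EuclideanSpace ℝ (Fin 4)) N) (_ : IsManifold (𝓡 4) ∞ N), Literature.Topology.FourManifolds.IsOpenGluing (𝓡 4) (𝓘(ℝ, EuclideanSpace ℝ (Fin 3)).prod (𝓡 1)) (𝓡 4) (A := ↥(⟨(⋃ i, Set.range ⇑(K i))ᶜ, (isClosed_iUnion_of_finite fun i => (K i).isClosed_range).isOpen_compl⟩ : TopologicalSpace.Opens (Metric.sphere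 (0 : EuclideanSpace ℝ (Fin 5)) 1))) (B := ↥(⟨⋃ i : Fin m, Prod.fst ⁻¹' Metric.ball (WithLp.toLp 2 ![(3 * (i : ℕ) : ℝ), 0, 0] : EuclideanSpace ℝ (Fin 3)) 1, isOpen_iUnion fun _ => Metric.isOpen_ball.preimage continuous_fst⟩ : TopologicalSpace.Opens ((EuclideanSpace ℝ (Fin 3)) × Metric.sphere (0 : EuclideanSpace ℝ (Fin 2)) 1))) (P := N) (fun a b => ∃ (i : Fin m) (x : Metric.sphere (0 : EuclideanSpace ℝ (Fin 3)) 1) (u : Metric.sphere (0 : EuclideanSpace ℝ (Fin 2)) 1) (t : ℝ), t ∈ Set.Ioo (0 : ℝ) 1 ∧ (b : (EuclideanSpace ℝ (Fin 3)) × Metric.sphere (0 : EuclideanSpace ℝ (Fin 2)) 1).1 = (WithLp.toLp 2 ![(3 * (i : ℕ) : ℝ), 0, 0] : EuclideanSpace ℝ (Fin 3)) + t • (x : EuclideanSpace ℝ (Fin 3)) ∧ (b : (EuclideanSpace ℝ (Fin 3)) × Metric.sphere (0 : EuclideanSpace ℝ (Fin 2)) 1).2 = u ∧ (a : Metric.sphere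 (0 : EuclideanSpace ℝ (Fin 5)) 1) = ν i (x, t • (u : EuclideanSpace ℝ (Fin 2)))) ∧ ∃ g : Literature.Geometry.Lorentzian.PseudoRiemannianMetric (𝓡 4) ∞ (EuclideanSpace ℝ (Fin 4)) (TangentSpace (𝓡 4) : N → Type _), ∃ _ : g.HasLeviCivita, g.IsRiemannian ∧ ∀ x, 0 < g.scalarCurvature x) → ∃ g : Literature.Geometry.Lorentzian.PseudoRiemannianMetric (𝓡 4) ∞ (EuclideanSpace ℝ (Fin 4)) (TangentSpace (𝓡 4) : M → Type _), ∃ _ : g.HasLeviCivita, g.IsRiemannian ∧ ∀ x, 0 < g.scalarCurvature x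

/-- item stmt-SmoothPoincare4-14811 · assembly · rank 1 · open · by planner
sources: Kirby1997, GromovLawson1980
[assembly] PscBranchLink → ConeAbsorption → PscSpheresStandard → SmoothPoincare4 (provable now; it
is `closes`). -/
@[route_item "route-SmoothPoincare4-SmallBranchSpheres"]
def Assembly : Prop :=
  PscBranchLink → ConeAbsorption → PscSpheresStandard → SmoothPoincare4

/-! D-0027 §2.1 — DECIDING THEOREM (planner-authored via `route open/edit --closes-file`; by planner-rrepair-SmoothPoincare4-SmallBranchSph-61bceef9-0 2026-08-15T20:16:58Z):
its hypotheses are this route's items and its conclusion the sub-problem Statement (glue_lint), and it elaborates with this file. -/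

@[closes "route-SmoothPoincare4-SmallBranchSpheres"] theorem closes (hC : PscBranchLink) (hA : ConeAbsorption) (hS : PscSpheresStandard) :
    _root_.SmoothPoincare4 := by
  intro M _ _ _ _ _ e
  obtain ⟨m, K, ν, p, σ, hnf, hsurg⟩ := hC M e
  exact hS M e (hA M m K ν p σ hnf hsurg)

end Summit.SmoothPoincare4.SmoothPoincare4.Theses.SmallBranchSpheres
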